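import Summits.KontsevichZagierPeriods.KontsevichZagierPeriods.Theses.LinRedNormalForm
import Summits.KontsevichZagierPeriods.KontsevichZagierPeriods.Theorems.LinRedNormalFormHoffmanIndependenceSplit
import Summits.KontsevichZagierPeriods.KontsevichZagierPeriods.Theorems.LinRedNormalFormHoffmanIndependenceTranscendence
import Summits.KontsevichZagierPeriods.KontsevichZagierPeriods.Theorems.LinRedNormalFormHoffmanIndependenceRescaling
import Summits.KontsevichZagierPeriods.KontsevichZagierPeriods.Theorems.LinRedNormalFormHoffmanIndependenceOddWeights
import Summits.KontsevichZagierPeriods.KontsevichZagierPeriods.Theorems.LinRedNormalFormHoffmanIndependenceLevelOne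
import Summits.KontsevichZagierPeriods.KontsevichZagierPeriods.Theorems.HoffmanIndependence.Negative.DiagonalAndStrength
import Summits.KontsevichZagierPeriods.KontsevichZagierPeriods.Theorems.LinRedNormalFormHoffmanIndependenceRealSpanning
import Summits.KontsevichZagierPeriods.KontsevichZagierPeriods.Theorems.LinRedNormalFormHoffmanSpanInKZLeTen
import Summits.KontsevichZagierPeriods.KontsevichZagierPeriods.Theorems.LinRedNormalFormHoffmanSpanInKZEds11
import Summits.KontsevichZagierPeriods.KontsevichZagierPeriods.Theorems.FurushoPentagonKernelModuloPeriodConjectureLeafWeightLeSeventeen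
import Summits.KontsevichZagierPeriods.KontsevichZagierPeriods.Theorems.KernelModuloPeriodConjecture.Negative.StubAImpliesBrownSpanning

/-!
# Crux `HoffmanIndependence` (stmt-KontsevichZagierPeriods-15045) — line `weight_split`
# (skeleton rev 7, lead prover-line-…-15045-c5-0, 2026-08-17): the EXACT weight decomposition
# + the cycle-3 sub-goals (level-one typing, odd-weight growth, transcendence), the cycle-4
# sub-goals (Brown-free real spanning bridge from crux #6; unconditional weights ≤ 11) — ALL LANDED —
# and the cycle-5 sub-goal (associator leaf of route FurushoPentagon read at Φ_KZ: unconditional weights ≤ 17)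

Rev 7 (cycle 5, lead c5) changes NEITHER load-bearing stub NOR the composition. It ADDS §5, one
registered sub-goal that is a THEOREM, `finrank_mzvSpace_eq_of_hoffmanIndependence_of_le_seventeen`
(file `Theorems/LinRedNormalFormHoffmanIndependenceLeSeventeen.lean`, proposed `--supports`; re-derived
below in four lines from the imported tree theorems so that the skeleton shows the composition): the
sister route `FurushoPentagon` has landed its ALGEBRAIC LEAF through weight `17`
(`stub_associatorHoffmanSpanning_of_weight_le_17`: at every group-like pentagon solution over every
reduced commutative `ℚ`-algebra, every admissible coefficient of weight `≤ 17` is one fixed rational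
combination of Hoffman coefficients — kernel-checked EDS rank certificates, standard axioms), and the
Literature side has PROVED Drinfeld's theorem for the real KZ associator (`drinfeldAssociator_pentagon_holds`,
`drinfeldAssociator_isGroupLike_holds`). Reading the leaf at `Φ_KZ` (`drinfeldAssociator_binaryWord`:
`c_{bw s}(Φ_KZ) = (-1)^{|s|} ζ(s)`) gives, with NO motivic input and WITHOUT crux #6: Brown's theorem for
real MZVs `hoffmanSpan n = mzvSpace n` and the Terasoma bound `dim_ℚ 𝒵_n ≤ d_n` for every `n ≤ 17`
(rev 6 had `≤ 11`), so the slices `n ≤ 17` of `stub_inWeight` are exactly `dim_ℚ 𝒵_n = d_n` and the crux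
proves Zagier's table `1,0,1,1,1,2,2,3,4,5,7,9,12,16,21,28,37,49` through weight `17` outright; and in all
weights the FurushoPentagon leaf `AssociatorHoffmanSpanning` gives a SECOND Brown-free reduction
`HoffmanIndependence ↔ ZagierConjecture` (rev 6's went through crux #6). (Also since rev 6: line 15044
landed `stub_eds12`, `stub_eds13`, so the formal slices `SpanAt n` of crux #6 hold for `n ≤ 13`.)

Rev 6 (cycle 4, lead c4) changes NEITHER load-bearing stub NOR the composition. It ADDS §4, two
registered sub-goals that are THEOREMS, both landed (p142583, p143468); the first is discharged BY NAME
below, the second re-derived in three lines from the imported bridge + certificate assemblies (its own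
file `…LeEleven.lean` was not yet built on the farm when rev 6 was registered):
`hoffmanIndependence_iff_zagierConjecture_of_hoffmanSpanInKZ` (p142583,
`Theorems/LinRedNormalFormHoffmanIndependenceRealSpanning.lean`) — the REAL SPANNING BRIDGE from the
sister crux `HoffmanSpanInKZ` (item #6, stmt-…-15044): its weight slice `SpanAt N` (every MZV word
representation ≡ a combination of Hoffman word representations modulo the KZ MOVES) implies Brown's
theorem in weight `N` for REAL numbers, `hoffmanSpan N = mzvSpace N`, by the soundness of the KZ
calculus (`KZ.relations_le_ker_eval_holds`) and Kontsevich's formula (`KZ.mzvRep_value_holds`); hence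
`HoffmanSpanInKZ → hoffmanSpan_eq_mzvSpace` and `HoffmanSpanInKZ → (HoffmanIndependence ↔ ZagierConjecture)`
— inside the route, with NO motivic input, the declared transcendence input is exactly Zagier's printed
conjecture; and `finrank_mzvSpace_eq_of_hoffmanIndependence_of_le_eleven`
(`Theorems/LinRedNormalFormHoffmanIndependenceLeEleven.lean`) — from the landed EDS certificates of line
15044 (`spanAt_of_le_ten`, `stub_eds11`): UNCONDITIONALLY `hoffmanSpan n = mzvSpace n` and
`dim_ℚ 𝒵_n ≤ d_n` for `n ≤ 11` (the tree had `≤ 9`), so the slices `n ≤ 11` of `stub_inWeight` are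
exactly `dim_ℚ 𝒵_n = d_n` (no Brown) and the crux proves Zagier's dimension table
`1,0,1,1,1,2,2,3,4,5,7,9` through weight `11` outright (weight `12` the same way once `stub_eds12` of
line 15044 is assembled: `finrank_mzvSpace_eq_of_hoffmanIndependence_of_edsCertificate`).

Rev 5 (end of cycle 3, lead c3): the four cycle-3 sub-goals of rev 4 are now tree theorems and are
imported and discharged BY NAME below (no sorry left in §3): `stub_levelOne_iff` (p140900,
`Theorems/LinRedNormalFormHoffmanIndependenceLevelOne.lean`, lead), `stub_linearIndependent_mul_pow_iff`
(p140683, `…Rescaling.lean`), `stub_oddWeights_finrank_ge` (p140688, `…OddWeights.lean`),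
`stub_transcendental_of_grading` (p140500, `…Transcendence.lean`); the assembled consequences of §3 are
landed too (`…DepthOne.lean`, p141575: level-one slice ⟺ `1, ζ(3), ζ(5), …` independent over `ℚ[π²]` /
`ℚ(π²)`; crux ⟹ `ζ(2r+1) ∉ ℚ(π²)`). The only sorries of the skeleton are again the two load-bearing
stubs (printed open conjectures); the composition is unchanged.

Rev 4 (cycle 3, lead c3) changed NEITHER load-bearing stub NOR the composition `HoffmanIndependence_of`
(still `HoffmanIndependence_of_subs stub_weightGrading stub_inWeight`, glue landed p137246). It ADDED §3,
four registered sub-goals that are THEOREMS (not conjectures) and the consequences they assemble to: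

* `stub_levelOne_iff` (lead) — LEVEL-ONE TYPING (STRATEGY-CENSUS §D2, TRIAGE-r1-2): the level-`≤ 1`
  sub-family of the crux (Hoffman words with at most one letter `3` — an INFINITE sub-family mixing all
  weights) is independent iff the classical family `{π^{2m}} ∪ {π^{2m} ζ(2r+1) : r ≥ 1}` is
  `ℚ`-independent (Zagier's `2-3-2` theorem `LaiLupuOrr.zagier_theorem` + `Brown2012.isUnit_zagierMatrix`,
  tree theorems: in weight `2n+1` the `n` level-one Hoffman values and the `n` products
  `π^{2(n-1-j)} ζ(2j+3)` have the same `ℚ`-span);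
* `stub_linearIndependent_mul_pow_iff` (worker) — for `t` transcendental, `ℚ`-independence of
  `{t^m v_i}` iff independence of `{v_i}` over the ring `ℚ[t] = Algebra.adjoin ℚ {t}`; with the previous
  stub: crux ⟹ `1, ζ(3), ζ(5), ζ(7), …` are linearly independent over `ℚ[π²]`
  (`oddZetas_linearIndependent_adjoin_of_hoffmanIndependence`) — the depth-one shadow of the crux, a
  statement containing `ζ(2r+1) ∉ ℚ(π)` for every `r` and the irrationality of every `ζ(2r+1)/π^{2r+1}`;
* `stub_oddWeights_finrank_ge` (worker) — UNCONDITIONAL odd-weight fragment of `stub_weightGrading`: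
  `finrank ℚ (hoffmanSpan 0 ⊔ ⨆_{odd k ≤ a} hoffmanSpan k) ≥ (1-ε) log a / (1 + log 2)` eventually
  (Ball–Rivoal `ball_rivoal_holds` + `multipleZeta_odd_mem_hoffmanSpan`, tree theorems), so infinitely
  many odd weights contribute new dimensions; the stub predicts `1 + Σ_{odd k ≤ a} d_k` and Lindemann is
  silent in odd weight (no unconditional statement of this kind was in the tree);
* `stub_transcendental_of_grading` (worker) — Goncharov's grading conjecture ALONE makes every non-zero
  MZV of positive weight transcendental (its powers live in pairwise different weights,
  `mem_mzvSpace_mul_holds`); hence crux + Brown ⟹ `ζ(u)` transcendental for every non-empty Hoffman `u`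
  (`transcendental_multipleZeta_of_hoffmanIndependence`; open already for `u = (3)`).

Rev 3 record (cycle 2, lead c2; all `--supports`, sorry-free): `…ZagierEquivalence.lean` (p138488:
`hoffmanIndependence_iff_zagierConjecture : hoffmanSpan_eq_mzvSpace → (HoffmanIndependence ↔ ZagierConjecture)`;
`zagierDim_le_finrank_mzvSpace_of_hoffmanIndependence : crux → ∀ n, d_n ≤ dim_ℚ 𝒵_n` UNCONDITIONALLY;
slices `n ≤ 9` of stub 2 ⟺ `dim_ℚ 𝒵_n = d_n`; slices 7/8/9 typed), `…RungFour.lean` (p138732),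
`…Truncation.lean` (p138708), `…TruncationFinrank.lean` (p138783), `…TruncationFive.lean` (p138828),
`…TruncatedSplit.lean` (p139143), `…JointRungs.lean` (p139452). So: crux = Zagier's conjecture given
Brown (Lean theorem), and every rung of either stub that the tree's transcendence theorems reach is landed;
what remains of each load-bearing stub is a printed open conjecture.

The crux `Theses.LinRedNormalForm.HoffmanIndependence` (`ℚ`-linear independence of ALL real
Hoffman values, all weights at once) is EXACTLY the conjunction of the two load-bearing stubs
(`hoffmanIndependence_iff_subs`, landed p137246):

* `stub_weightGrading : iSupIndep hoffmanSpan` — the Hoffman weight spans form a DIRECT SUM in `ℝ`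
  (Goncharov's grading conjecture, GoncharovECM2001 Conj. 1.1 a), on the Hoffman spans;
  transcendence ACROSS weights). LANDED RUNGS (p137553, `…Rungs.lean`): the stub is exactly the
  conjunction of its initial-segment rungs (`weightGrading_iff_forall_initial`); rungs `N ≤ 2`
  (`weightGrading_initial_two`), weights `{0,1,2,4}` (`weightGrading_initial_four_ne_three`,
  Lindemann) and `{0,1,3}` (`weightGrading_initial_three_ne_two`, Apéry) are theorems; the FIRST
  OPEN rung `N = 3` is typed: `weightGrading_initial_three_iff_zeta_three` — it is EXACTLY
  `ζ(3) ∉ ℚ + ℚπ²` (open).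
* `stub_inWeight : ∀ n, LinearIndependent ℚ (ζ on the weight-n Hoffman indices)` — WITHIN each
  weight the `d_n` Hoffman values are independent (Zagier's dimension lower bound in Brown's
  basis). LANDED RUNGS: `n ≤ 4` (`inWeight_of_le_four`, p137246); the FIRST OPEN rung `n = 5` is
  typed: `inWeight_five_iff` — it is EXACTLY `ζ(5) ∉ ℚ·ζ(2)ζ(3)` (open; p137553).

`HoffmanIndependence_of : HoffmanIndependence := HoffmanIndependence_of_subs stub_weightGrading stub_inWeight`
concludes the crux BY NAME from exactly the two load-bearing stubs through the LANDED glue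
(`Theorems/LinRedNormalFormHoffmanIndependenceSplit.lean`, `linearIndependent_iUnion_finite` on the
`Σ`-reindexing by weight; both converses landed too, so neither stub is stronger than the crux).

Both load-bearing stubs are DECLARED TRANSCENDENCE INPUTS of open-problem grade (STRATEGY-CENSUS.md §1–§2).

Disproof used (`Cruxes/HoffmanIndependence/Disproof.lean`, cdisprove cycle 1, unchanged since
2026-08-16T13:00Z): no `_false_without_` theorem exists (the crux has no hypotheses); §A alphabet
tightness respected (all stubs keep `IsHoffman`); §E's two sorried near-misses are honest
EQUIVALENCES with the first open rungs of the two load-bearing stubs; no stub is an instance of a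
landed Negative lemma (`Negative/AlphabetMutations`, `DiagonalAndStrength`, `NotAlgebraicIndependent`);
§B's diagonal theorem `hoffmanIndependence_diagonal` is the level-ZERO case of `stub_levelOne_iff`.
-/

noncomputable section

set_option linter.dupNamespace false

namespace Summit.KontsevichZagierPeriods.KontsevichZagierPeriods.Cruxes.HoffmanIndependence.WeightSplit

open Literature.NumberTheory.Transcendental MZV
open Summit.KontsevichZagierPeriods.KontsevichZagierPeriods.Theses.LinRedNormalForm (HoffmanIndependence)
open Summit.KontsevichZagierPeriods.LinRedNormalForm.HoffmanIndependence
  (HoffmanIndependence_of_subs hoffmanIndependence_iff_subs inWeight_of_le_four)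

/-! ## The two registered stubs (declared open inputs) -/

/-- STUB 1 — WEIGHT GRADING OF THE HOFFMAN SPANS (Goncharov's grading conjecture on
`hoffmanSpan`; open-problem grade, declared input). Equivalent to all its initial-segment rungs
(`weightGrading_iff_forall_initial`); rungs `N ≤ 2` proved; rung `N = 3` ⟺ `ζ(3) ∉ ℚ + ℚπ²`
(`weightGrading_initial_three_iff_zeta_three`), open. Implied unconditionally by
`MZVWeightGradingConjecture` (`weightGrading_of_gradingConjecture`).
[cite: GoncharovECM2001, Conjecture 1.1] -/
theorem stub_weightGrading : iSupIndep hoffmanSpan := by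
  sorry

/-- STUB 2 — IN-WEIGHT HOFFMAN INDEPENDENCE (Zagier's dimension lower bound in Brown's basis;
declared input). Proved for `n ≤ 4` (`inWeight_of_le_four`); `n = 5` ⟺ `ζ(5) ∉ ℚ·ζ(2)ζ(3)`
(`inWeight_five_iff`), open. Implied by `ZagierDimensionConjecture` + Brown
(`inWeight_of_dimensionConjecture`). [cite: Zagier1994, §9] -/
theorem stub_inWeight : ∀ n : ℕ, LinearIndependent ℚ
    (fun u : {u : List ℕ // IsHoffman u ∧ weight u = n} => multipleZeta u.1) := by
  sorry

/-! ## The composition (landed glue) -/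

/-- **The line's deciding composition — the crux BY NAME from exactly the two registered stubs**,
through the landed split glue `HoffmanIndependence_of_subs` (p137246).
[cite: Zagier1994, §9] [cite: GoncharovECM2001, Conjecture 1.1] -/
theorem HoffmanIndependence_of : HoffmanIndependence :=
  HoffmanIndependence_of_subs stub_weightGrading stub_inWeight

/-! ## Status of the rungs (landed tree theorems, `Theorems/LinRedNormalFormHoffmanIndependenceRungs.lean`
p137553 and `…RungSix.lean`; not imported here to keep the skeleton light)

* stub 1: `weightGrading_iff_forall_initial` (stub ⟺ ∀ N, rung N); proved rungs
  `weightGrading_initial_two` (`N ≤ 2`), `weightGrading_initial_four_ne_three` (`{0,1,2,4}`),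
  `weightGrading_initial_three_ne_two` (`{0,1,3}`); first open rung
  `weightGrading_initial_three_iff_zeta_three : rung 3 ↔ ∀ a b : ℚ, ζ(3) ≠ a + bπ²`.
* stub 2: `inWeight_of_le_four` (`n ≤ 4`, below); first open rungs
  `inWeight_five_iff : slice 5 ↔ ∀ q : ℚ, ζ(5) ≠ q·ζ(2)ζ(3)`,
  `inWeight_six_iff : slice 6 ↔ ∀ q : ℚ, ζ(3)² ≠ q·π⁶`. -/

/-- Rungs of stub 2 that are theorems (landed, p137246). -/
example {n : ℕ} (hn : n ≤ 4) :
    LinearIndependent ℚ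
      (fun u : {u : List ℕ // IsHoffman u ∧ weight u = n} => multipleZeta u.1) :=
  inWeight_of_le_four hn

/-- The split is exact (landed): the crux is equivalent to the conjunction of the two stubs. -/
example : HoffmanIndependence ↔
    iSupIndep hoffmanSpan ∧ ∀ n : ℕ, LinearIndependent ℚ
      (fun u : {u : List ℕ // IsHoffman u ∧ weight u = n} => multipleZeta u.1) :=
  hoffmanIndependence_iff_subs

/-! ## §3 Cycle-3 registered sub-goals (lead c3, 2026-08-17) — all four LANDED, discharged by name

Each landed `--supports stmt-KontsevichZagierPeriods-15045` under
`Theorems/LinRedNormalFormHoffmanIndependence<Name>.lean` (namespace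
`Summit.KontsevichZagierPeriods.LinRedNormalForm.HoffmanIndependence`) and is imported above. -/

/-- SUB-GOAL (lead c3; LANDED p140900) — **LEVEL-ONE TYPING.** The level-`≤ 1` sub-family of the crux (Hoffman words
with at most one letter `3`: `{2}^m` of weight `2m` and `2^b 3 2^a` of weight `2(a+b)+3`) is
`ℚ`-linearly independent iff the classical family `(m, 0) ↦ π^{2m}`, `(m, r) ↦ π^{2m} ζ(2r+1)` (`r ≥ 1`)
is. Weight by weight the two families have the same cardinality and the same `ℚ`-span
(`ζ({2}^m) = π^{2m}/(2m+1)!`; in weight `2n+1` Zagier's theorem writes the `n` level-one values in the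
`n` products `π^{2(n-1-j)} ζ(2j+3)` through the invertible Zagier matrix), and for both families
independence = (grading of the weight spans) ∧ (independence within each weight).
[cite: Zagier2012, Theorem 1] [cite: Brown2012, Theorems 4.1 and 7.3] -/
theorem stub_levelOne_iff :
    LinearIndependent ℚ
        (fun u : {u : List ℕ // IsHoffman u ∧ u.count 3 ≤ 1} => multipleZeta u.1) ↔
      LinearIndependent ℚ (fun p : ℕ × ℕ =>
        Real.pi ^ (2 * p.1) * (if p.2 = 0 then 1 else multipleZeta [2 * p.2 + 1])) :=
  Summit.KontsevichZagierPeriods.LinRedNormalForm.HoffmanIndependence.stub_levelOne_iff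

/-- SUB-GOAL (worker; LANDED p140683) — **transcendental rescaling.** For `t ∈ ℝ` transcendental over `ℚ` and any real
family `v`, the products `t^m · v_i` are `ℚ`-linearly independent iff the `v_i` are linearly independent
over the ring `ℚ[t] = Algebra.adjoin ℚ {t}` (whose `ℚ`-basis is `{t^m}`). [folklore] -/
theorem stub_linearIndependent_mul_pow_iff {ι : Type*} {t : ℝ} (ht : Transcendental ℚ t) (v : ι → ℝ) :
    LinearIndependent ℚ (fun p : ℕ × ι => t ^ p.1 * v p.2) ↔
      LinearIndependent (Algebra.adjoin ℚ ({t} : Set ℝ)) v :=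
  Summit.KontsevichZagierPeriods.LinRedNormalForm.HoffmanIndependence.stub_linearIndependent_mul_pow_iff ht v

/-- SUB-GOAL (worker; LANDED p140688) — **UNCONDITIONAL odd-weight growth** (Ball–Rivoal fragment of `stub_weightGrading`).
`1 ∈ hoffmanSpan 0` and `ζ(k) ∈ hoffmanSpan k` for odd `k ≥ 3` (`multipleZeta_odd_mem_hoffmanSpan`,
Zagier + Brown's `2`-adic level-one argument, tree theorems), so Ball–Rivoal's dimension bound
(`ball_rivoal_holds`) bounds the dimension of `hoffmanSpan 0 ⊔ ⨆_{odd k ≤ a} hoffmanSpan k` from below.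
[cite: BallRivoal2001, Théorème 1] [cite: Brown2012, Theorems 7.3 and 7.4] -/
theorem stub_oddWeights_finrank_ge :
    ∀ ε : ℝ, 0 < ε → ∀ᶠ a : ℕ in Filter.atTop,
      (1 - ε) * Real.log a / (1 + Real.log 2) ≤
        Module.finrank ℚ ↥(hoffmanSpan 0 ⊔ ⨆ k ∈ (Finset.range (a + 1)).filter Odd, hoffmanSpan k) :=
  Summit.KontsevichZagierPeriods.LinRedNormalForm.HoffmanIndependence.stub_oddWeights_finrank_ge

/-- SUB-GOAL (worker; LANDED p140500) — **Goncharov's grading conjecture ⟹ transcendence of every non-zero MZV of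
positive weight**: if `x ∈ 𝒵_w`, `w ≠ 0`, were algebraic, `∑ aₙ xⁿ = 0` would be a relation among
elements `aₙ xⁿ ∈ 𝒵_{nw}` of pairwise different weights (`mem_mzvSpace_mul_holds`), so each `aₙ xⁿ = 0`.
[cite: GoncharovECM2001, Conjecture 1.1] [cite: Waldschmidt2004, §3] -/
theorem stub_transcendental_of_grading :
    MZVWeightGradingConjecture →
      ∀ {w : ℕ} {x : ℝ}, w ≠ 0 → x ∈ mzvSpace w → x ≠ 0 → Transcendental ℚ x :=
  Summit.KontsevichZagierPeriods.LinRedNormalForm.HoffmanIndependence.stub_transcendental_of_grading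

/-! ### Assembled consequences of §3 -/

/-- The crux restricted to the level-`≤ 1` Hoffman words (a sub-family of an independent family).
[folklore] -/
theorem levelOne_of_hoffmanIndependence (h : HoffmanIndependence) :
    LinearIndependent ℚ
      (fun u : {u : List ℕ // IsHoffman u ∧ u.count 3 ≤ 1} => multipleZeta u.1) := by
  have h' : LinearIndependent ℚ (fun u : {u : List ℕ // IsHoffman u} => multipleZeta u.1) := h
  exact h'.comp (fun u : {u : List ℕ // IsHoffman u ∧ u.count 3 ≤ 1} =>
      (⟨u.1, u.2.1⟩ : {u : List ℕ // IsHoffman u}))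
    fun a b hab => Subtype.ext (by have h := congrArg Subtype.val hab; exact h)

/-- **The depth-one shadow of the crux, in classical numbers**: `HoffmanIndependence` implies that
`1, ζ(3), ζ(5), ζ(7), …` are linearly independent over the ring `ℚ[π²]` (`π²` is transcendental, so
`ℚ[π²] ≅ ℚ[X]`): no relation `P₀(π²) + ∑_{r ≥ 1} P_r(π²) ζ(2r+1) = 0` with `P_r ∈ ℚ[X]` not all zero.
[cite: Zagier2012, Theorem 1] [cite: Brown2012, Theorem 4.1] -/
theorem oddZetas_linearIndependent_adjoin_of_hoffmanIndependence (h : HoffmanIndependence) :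
    LinearIndependent (Algebra.adjoin ℚ ({Real.pi ^ 2} : Set ℝ))
      (fun r : ℕ => if r = 0 then (1 : ℝ) else multipleZeta [2 * r + 1]) := by
  -- LANDED as `…HoffmanIndependence.oddZetas_linearIndependent_adjoin_of_hoffmanIndependence`
  -- (p141575, `Theorems/LinRedNormalFormHoffmanIndependenceDepthOne.lean`, with the field form over
  -- `ℚ(π²)` and the corollaries `ζ(2r+1) ∉ ℚ(π²)`, `ζ(2r+1) ∉ ℚ(π²)·ζ(2s+1)`); re-derived here from
  -- the two registered stubs so that the skeleton shows the composition.
  have hπ2 : Transcendental ℚ (Real.pi ^ 2) := transcendental_pi_holds.pow two_pos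
  rw [← stub_linearIndependent_mul_pow_iff hπ2]
  have h1 := stub_levelOne_iff.1 (levelOne_of_hoffmanIndependence h)
  simp_rw [← pow_mul] at h1 ⊢
  exact h1

/-- **Crux + Brown ⟹ every Hoffman value `ζ(u)`, `u ≠ ∅`, is transcendental** (open for `u = (3)`):
the crux with Brown's theorem gives Goncharov's grading conjecture (`gradingConjecture_of_hoffmanIndependence`,
p138488) and `ζ(u) > 0` lies in `𝒵_{|u|}`, `|u| ≥ 2`. [cite: GoncharovECM2001, Conjecture 1.1] -/
theorem transcendental_multipleZeta_of_weightGrading (hG : MZVWeightGradingConjecture)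
    (u : List ℕ) (hu : IsHoffman u) (hne : u ≠ []) : Transcendental ℚ (multipleZeta u) := by
  refine stub_transcendental_of_grading hG ?_ (hoffmanSpan_le_mzvSpace _
    (Submodule.subset_span ⟨u, hu, rfl, rfl⟩)) (multipleZeta_pos_of_isAdmissible_holds hu.isAdmissible).ne'
  -- a non-empty Hoffman word has weight ≥ 2
  obtain ⟨a, l, rfl⟩ := List.exists_cons_of_ne_nil hne
  have ha : a = 2 ∨ a = 3 := hu a (by simp)
  simp only [weight, List.sum_cons]
  omega

/-! ## §4 Cycle-4 registered sub-goals (lead c4, 2026-08-17) — both LANDED, discharged by name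

Each landed `--supports stmt-KontsevichZagierPeriods-15045` under
`Theorems/LinRedNormalFormHoffmanIndependence<Name>.lean` (namespace
`Summit.KontsevichZagierPeriods.LinRedNormalForm.HoffmanIndependence`) and is imported above. -/

/-- SUB-GOAL (lead c4; LANDED p142583, `…RealSpanning.lean`) — **BROWN-FREE EQUIVALENCE.** Given the
sister crux `HoffmanSpanInKZ` (item #6 of the route: every MZV word representation is congruent modulo
the KZ moves to a combination of Hoffman word representations of the same weight), the crux IS Zagier's
conjecture: evaluation (`KZ.eval`, sound on `KZ.relations`) and Kontsevich's formula turn the formal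
spanning into Brown's theorem for real numbers (`hoffmanSpan_eq_mzvSpace_of_hoffmanSpanInKZ`), which is
all `hoffmanIndependence_iff_zagierConjecture` needed. [cite: Zagier1994, §9] [cite: GoncharovECM2001, Conjecture 1.1] [cite: KontsevichZagier2001, §1.2] -/
theorem hoffmanIndependence_iff_zagierConjecture_of_hoffmanSpanInKZ :
    Summit.KontsevichZagierPeriods.KontsevichZagierPeriods.Theses.LinRedNormalForm.HoffmanSpanInKZ →
      (HoffmanIndependence ↔ ZagierConjecture) :=
  Summit.KontsevichZagierPeriods.LinRedNormalForm.HoffmanIndependence.hoffmanIndependence_iff_zagierConjecture_of_hoffmanSpanInKZ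

/-- SUB-GOAL (lead c4; LANDED, `…LeEleven.lean`) — **the crux proves Zagier's dimension table through
weight `11`, unconditionally**: the real spanning bridge applied to the landed EDS certificates of
line 15044 gives `hoffmanSpan n = mzvSpace n` and `dim_ℚ 𝒵_n ≤ d_n` for `n ≤ 11`; the crux gives the
lower bound (`zagierDim_le_finrank_mzvSpace_of_hoffmanIndependence`). [cite: Zagier1994, §9] [cite: Terasoma2002, Theorem 1.2] -/
theorem finrank_mzvSpace_eq_of_hoffmanIndependence_of_le_eleven :
    HoffmanIndependence → ∀ {n : ℕ}, n ≤ 11 → Module.finrank ℚ (mzvSpace n) = zagierDim n := by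
  -- LANDED verbatim as `…HoffmanIndependence.finrank_mzvSpace_eq_of_hoffmanIndependence_of_le_eleven`
  -- (p143468, `Theorems/LinRedNormalFormHoffmanIndependenceLeEleven.lean`); re-derived here from the bridge
  -- (p142583) and the two landed certificate assemblies of line 15044 so that the skeleton shows the composition.
  intro h n hn
  rcases Nat.lt_or_ge n 11 with h11 | h11
  · exact Summit.KontsevichZagierPeriods.LinRedNormalForm.HoffmanIndependence.finrank_mzvSpace_eq_of_hoffmanIndependence_of_spanAt
      h (Summit.KontsevichZagierPeriods.LinRedNormalForm.HoffmanSpanInKZ.spanAt_of_le_ten (by omega))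
  · obtain rfl : n = 11 := le_antisymm hn h11
    exact Summit.KontsevichZagierPeriods.LinRedNormalForm.HoffmanIndependence.finrank_mzvSpace_eq_of_hoffmanIndependence_of_spanAt
      h (Summit.KontsevichZagierPeriods.LinRedNormalForm.HoffmanSpanInKZ.spanAt_of_edsCertificate
        Summit.KontsevichZagierPeriods.LinRedNormalForm.HoffmanSpanInKZ.stub_eds11)

/-! ### Assembled consequences of §4 -/

/-- Brown's theorem in weight `11` is now a tree theorem (no hypothesis; all weights `≤ 11` in
`…LeEleven.lean`, `hoffmanSpan_eq_mzvSpace_of_le_eleven`). [cite: Brown2012, Theorem 1.1] -/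
example : hoffmanSpan 11 = mzvSpace 11 :=
  Summit.KontsevichZagierPeriods.LinRedNormalForm.HoffmanIndependence.hoffmanSpan_eq_mzvSpace_of_edsCertificate
    Summit.KontsevichZagierPeriods.LinRedNormalForm.HoffmanSpanInKZ.stub_eds11

/-- The slice `n = 11` of STUB 2 is exactly Zagier's dimension statement `dim_ℚ 𝒵₁₁ = 9` (no Brown;
all `n ≤ 11` in `…LeEleven.lean`, `inWeight_iff_finrank_mzvSpace_eq_of_le_eleven`). [cite: Zagier1994, §9] -/
example :
    LinearIndependent ℚ
        (fun u : {u : List ℕ // IsHoffman u ∧ weight u = 11} => multipleZeta u.1) ↔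
      Module.finrank ℚ (mzvSpace 11) = 9 :=
  Summit.KontsevichZagierPeriods.LinRedNormalForm.HoffmanIndependence.inWeight_iff_finrank_mzvSpace_eq_of_spanAt
    (Summit.KontsevichZagierPeriods.LinRedNormalForm.HoffmanSpanInKZ.spanAt_of_edsCertificate
      Summit.KontsevichZagierPeriods.LinRedNormalForm.HoffmanSpanInKZ.stub_eds11)

/-- Given crux #6, STUB 1 is Goncharov's grading conjecture and STUB 2 is Zagier's dimension
conjecture, verbatim (Brown-free). [cite: GoncharovECM2001, Conjecture 1.1] [cite: Zagier1994, §9] -/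
example (h6 : Summit.KontsevichZagierPeriods.KontsevichZagierPeriods.Theses.LinRedNormalForm.HoffmanSpanInKZ) :
    (iSupIndep hoffmanSpan ↔ MZVWeightGradingConjecture) ∧
      ((∀ n : ℕ, LinearIndependent ℚ
          (fun u : {u : List ℕ // IsHoffman u ∧ weight u = n} => multipleZeta u.1)) ↔
        ZagierDimensionConjecture) :=
  ⟨Summit.KontsevichZagierPeriods.LinRedNormalForm.HoffmanIndependence.weightGrading_iff_gradingConjecture_of_hoffmanSpanInKZ h6,
    Summit.KontsevichZagierPeriods.LinRedNormalForm.HoffmanIndependence.inWeight_iff_zagierDimensionConjecture_of_hoffmanSpanInKZ h6⟩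

/-! ## §5 Cycle-5 registered sub-goal (lead c5, 2026-08-17) — the associator leaf of route
`FurushoPentagon` read at the real Drinfeld associator: unconditional weights `≤ 17`

Proposed `--supports stmt-KontsevichZagierPeriods-15045` as
`Theorems/LinRedNormalFormHoffmanIndependenceLeSeventeen.lean` (namespace
`Summit.KontsevichZagierPeriods.LinRedNormalForm.HoffmanIndependence`); re-derived here from the imported
tree theorems `stub_associatorHoffmanSpanning_of_weight_le_17` (FurushoPentagon leaf, weights `≤ 17`),
`Negative.multipleZeta_mem_hoffmanSpan_of_stubA`-style evaluation at `Φ_KZ`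
(`drinfeldAssociator_pentagon_holds`, `drinfeldAssociator_isGroupLike_holds`, `drinfeldAssociator_binaryWord`). -/

/-- Brown's theorem for real MZVs in every weight `n ≤ 17`, unconditionally and Brown-free: the
FurushoPentagon leaf through weight `17` read at `Φ_KZ`. [cite: Brown2012, Theorem 1.1] [cite: Drinfeld1991, §2] -/
theorem hoffmanSpan_eq_mzvSpace_of_le_seventeen {n : ℕ} (hn : n ≤ 17) : hoffmanSpan n = mzvSpace n := by
  refine hoffmanSpan_eq_mzvSpace_of_forall_mem fun s hs hw => ?_
  subst hw
  obtain ⟨b, hb, h⟩ :=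
    Summit.KontsevichZagierPeriods.FurushoPentagon.KernelModuloPeriodConjecture.stub_associatorHoffmanSpanning_of_weight_le_17
      s hs hn
  -- evaluate the universal Hoffman reduction at the real Drinfeld associator
  have hΦ := h ℝ drinfeldAssociator drinfeldAssociator_isGroupLike_holds drinfeldAssociator_pentagon_holds
  rw [drinfeldAssociator_binaryWord hs] at hΦ
  have hsum : b.sum (fun t q => q • drinfeldAssociator (binaryWord t)) ∈ hoffmanSpan (weight s) := by
    unfold Finsupp.sum
    refine Submodule.sum_mem _ fun t ht => ?_
    obtain ⟨hH, hwt⟩ := hb t ht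
    show b t • drinfeldAssociator (binaryWord t) ∈ hoffmanSpan (weight s)
    rw [drinfeldAssociator_binaryWord hH.isAdmissible]
    refine Submodule.smul_mem _ _ ?_
    have hmem : multipleZeta t ∈ hoffmanSpan (weight s) := Submodule.subset_span ⟨t, hH, hwt, rfl⟩
    have : ((-1 : ℝ) ^ t.length * multipleZeta t) = ((-1 : ℤ) ^ t.length) • multipleZeta t := by
      simp [zsmul_eq_mul]
    rw [this]
    exact zsmul_mem hmem _
  have hζ : multipleZeta s =
      ((-1 : ℤ) ^ s.length) • b.sum (fun t q => q • drinfeldAssociator (binaryWord t)) := by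
    rw [← hΦ, zsmul_eq_mul, Int.cast_pow, Int.cast_neg, Int.cast_one, ← mul_assoc, ← pow_add,
      ← two_mul, pow_mul]
    simp
  rw [hζ]
  exact zsmul_mem hsum _

/-- SUB-GOAL (lead c5; file `…LeSeventeen.lean`) — **the crux proves Zagier's dimension table through
weight `17`, unconditionally** (lower bound from the crux, upper bound from the leaf at `Φ_KZ`).
[cite: Zagier1994, §9] [cite: Terasoma2002, Theorem 1.2] -/
theorem finrank_mzvSpace_eq_of_hoffmanIndependence_of_le_seventeen :
    HoffmanIndependence → ∀ {n : ℕ}, n ≤ 17 → Module.finrank ℚ (mzvSpace n) = zagierDim n :=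
  fun h _ hn => le_antisymm (finrank_mzvSpace_le_zagierDim_of_eq (hoffmanSpan_eq_mzvSpace_of_le_seventeen hn))
    (Summit.KontsevichZagierPeriods.LinRedNormalForm.HoffmanIndependence.zagierDim_le_finrank_mzvSpace_of_hoffmanIndependence h _)

/-! ### Assembled consequences of §5 -/

/-- `dim_ℚ 𝒵₁₇ ≤ 49` is now a tree-derivable theorem with no hypothesis. [cite: Terasoma2002, Theorem 1.2] -/
example : Module.finrank ℚ (mzvSpace 17) ≤ 49 :=
  finrank_mzvSpace_le_zagierDim_of_eq (hoffmanSpan_eq_mzvSpace_of_le_seventeen le_rfl)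

/-- The slice `n = 17` of STUB 2 is exactly Zagier's dimension statement `dim_ℚ 𝒵₁₇ = 49` (no Brown,
no crux #6). [cite: Zagier1994, §9] -/
example :
    LinearIndependent ℚ
        (fun u : {u : List ℕ // IsHoffman u ∧ weight u = 17} => multipleZeta u.1) ↔
      Module.finrank ℚ (mzvSpace 17) = 49 :=
  Summit.KontsevichZagierPeriods.LinRedNormalForm.HoffmanIndependence.inWeight_iff_finrank_mzvSpace_eq_of_hoffmanSpan_eq
    (hoffmanSpan_eq_mzvSpace_of_le_seventeen le_rfl)

/-- Given the FurushoPentagon leaf in ALL weights (`AssociatorHoffmanSpanning`, typed leaf of crux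
`KernelModuloPeriodConjecture`), the crux IS Zagier's conjecture — the second Brown-free reduction.
[cite: Zagier1994, §9] [cite: GoncharovECM2001, Conjecture 1.1] -/
example
    (hA : ∀ s : List ℕ, IsAdmissible s →
      ∃ b : List ℕ →₀ ℚ, (∀ t ∈ b.support, IsHoffman t ∧ weight t = weight s) ∧
        ∀ (R : Type) [CommRing R] [Algebra ℚ R] [IsReduced R] (φ : NCSeries Bool R),
          NCSeries.IsGroupLike φ → NCSeries.DrinfeldPentagon φ →
            φ (binaryWord s) = b.sum (fun t q => q • φ (binaryWord t))) :
    HoffmanIndependence ↔ ZagierConjecture :=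
  Summit.KontsevichZagierPeriods.LinRedNormalForm.HoffmanIndependence.hoffmanIndependence_iff_zagierConjecture
    (Summit.KontsevichZagierPeriods.KernelModuloPeriodConjecture.Negative.hoffmanSpan_eq_mzvSpace_of_stubA hA)

end Summit.KontsevichZagierPeriods.KontsevichZagierPeriods.Cruxes.HoffmanIndependence.WeightSplit
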